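import Summits.Ventures.PercRepro.CrossTransversal
import Summits.Ventures.PercRepro.NearDominantHolds

/-!
# The overlap bound with the split bonus: (T′⁺)

proofs/P4-gen9.md §12.9. The two conflict-free three-type families of `CrossTransversal.lean`,
`famA = crossFam i j ∪ crossFam k j` and `famB = crossFam i k ∪ crossFam j k`, are SPLIT
families whenever both of their parts are nonempty: their members lie in two distinct crossing
cells, and distinct crossing cells are incomparable (`cross4_not_le_of_ne`), so no member of one part
is below a member of the other (`not_le_of_mem_crossFam`). The landed connectedness theorem
`msTightNoSplit` (a Marica–Schönheim-tight family of configurations cannot be split) therefore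
gives each of them one unit of slack beyond Marica–Schönheim,
`|F| + 1 ≤ |F \\ F|` (`card_add_one_le_card_diffs_of_split`), and the inclusion–exclusion of
`crossCount_add_le_topBotCount_add_inter` improves by two:

* **(T′⁺)** `crossCount_add_add_two_le_topBotCount_add_inter`:
  `crossCount + p_jk + 2 ≤ topBotCount + |D(famA) ∩ D(famB)|` whenever all three types occur;
* **`crossCount_le_topBotCount_of_inter_le_add_two`**: Lemma B whenever
  `|D(famA) ∩ D(famB)| ≤ p_jk + 2` for some labelling (the three-axis family of §12.8 has
  overlap exactly `p_jk + 1`, so this is the bound that covers it; `(T′)` alone misses it by one);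
* the `ThreeTypes` forms (`crossFam_nonempty_of_threeTypes`, `…_of_threeTypes`).
-/

namespace PercRepro

open Finset
open scoped FinsetFamily

section TransversalSplit

variable {S : Type} [Fintype S] [DecidableEq S]

/-- Distinct crossing cells are incomparable. -/
theorem cross4_not_le_of_ne {i k : Fin 3} (hik : i ≠ k) : ¬ cross4 i ≤ cross4 k := by
  intro h
  have hinf : cross4 i ⊓ cross4 k = cross4 i := inf_eq_left.2 h
  rw [cross4_inf_eq_bot hik] at hinf
  exact cross4_ne_bot i hinf.symm

/-- A member of `crossFam i j` is never below a member of `crossFam k j` (`i ≠ k`). -/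
theorem not_le_of_mem_crossFam {c : Config S → Setoid (Fin 4)} (hc : Monotone c)
    {i j k : Fin 3} (hik : i ≠ k) {A B : Config S} (hA : A ∈ crossFam cross4 c i j)
    (hB : B ∈ crossFam cross4 c k j) : ¬ A ≤ B := by
  intro hAB
  obtain ⟨-, eA, -⟩ := (mem_crossFam cross4 c).1 hA
  obtain ⟨-, eB, -⟩ := (mem_crossFam cross4 c).1 hB
  have h := hc hAB
  rw [eA, eB] at h
  exact cross4_not_le_of_ne hik h

/-- **A split family has one unit of Marica–Schönheim slack**: two nonempty disjoint families of
configurations with no comparable pair across satisfy `|s ∪ t| + 1 ≤ |(s ∪ t) \\ (s ∪ t)|`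
(Marica–Schönheim plus the landed connectedness theorem `msTightNoSplit`). -/
theorem card_add_one_le_card_diffs_of_split (s t : Finset (Config S)) (hs : s.Nonempty)
    (ht : t.Nonempty) (hdisj : Disjoint s t)
    (hcross : ∀ a ∈ s, ∀ b ∈ t, ¬ a ≤ b ∧ ¬ b ≤ a) :
    (s ∪ t).card + 1 ≤ ((s ∪ t) \\ (s ∪ t)).card := by
  have hle := Finset.card_le_card_diffs (s ∪ t)
  have hne : ((s ∪ t) \\ (s ∪ t)).card ≠ (s ∪ t).card := by
    intro heq
    obtain ⟨a, ha, b, hb, hab⟩ := msTightNoSplit s t hs ht hdisj heq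
    rcases hab with h | h
    · exact (hcross a ha b hb).1 h
    · exact (hcross a ha b hb).2 h
  omega

/-- `famA` is split when both parts are nonempty: `|famA| + 1 ≤ |D(famA)|`. -/
theorem card_famA_add_one_le {c : Config S → Setoid (Fin 4)} (hc : Monotone c) {i j k : Fin 3}
    (hik : i ≠ k) (h1 : (crossFam cross4 c i j).Nonempty) (h2 : (crossFam cross4 c k j).Nonempty) :
    (famA c i j k).card + 1 ≤ (famA c i j k \\ famA c i j k).card := by
  unfold famA
  refine card_add_one_le_card_diffs_of_split _ _ h1 h2 ?_ ?_
  · rw [Finset.disjoint_left]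
    intro ω hω hω'
    obtain ⟨-, e1, -⟩ := (mem_crossFam cross4 c).1 hω
    obtain ⟨-, e2, -⟩ := (mem_crossFam cross4 c).1 hω'
    exact hik (cross4_injective (e1.symm.trans e2))
  · intro a ha b hb
    exact ⟨not_le_of_mem_crossFam hc hik ha hb, not_le_of_mem_crossFam hc (Ne.symm hik) hb ha⟩

/-- `famB` is split when both parts are nonempty: `|famB| + 1 ≤ |D(famB)|`. -/
theorem card_famB_add_one_le {c : Config S → Setoid (Fin 4)} (hc : Monotone c) {i j k : Fin 3}
    (hij : i ≠ j) (h1 : (crossFam cross4 c i k).Nonempty) (h2 : (crossFam cross4 c j k).Nonempty) :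
    (famB c i j k).card + 1 ≤ (famB c i j k \\ famB c i j k).card := by
  unfold famB
  refine card_add_one_le_card_diffs_of_split _ _ h1 h2 ?_ ?_
  · rw [Finset.disjoint_left]
    intro ω hω hω'
    obtain ⟨-, e1, -⟩ := (mem_crossFam cross4 c).1 hω
    obtain ⟨-, e2, -⟩ := (mem_crossFam cross4 c).1 hω'
    exact hij (cross4_injective (e1.symm.trans e2))
  · intro a ha b hb
    exact ⟨not_le_of_mem_crossFam hc hij ha hb, not_le_of_mem_crossFam hc (Ne.symm hij) hb ha⟩

/-- `crossCount = p_ij + p_ik + p_kj` (the transversal count, unfolded). -/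
theorem crossCount_eq_transversal_three (c : Config S → Setoid (Fin 4)) {i j k : Fin 3} (hij : i ≠ j)
    (hik : i ≠ k) (hjk : j ≠ k) :
    crossCount cross4 c = (crossFam cross4 c i j).card + (crossFam cross4 c i k).card +
      (crossFam cross4 c k j).card := by
  rw [← card_transversal c hij hik hjk, transversal, Finset.card_union_of_disjoint,
    Finset.card_union_of_disjoint]
  · exact disjoint_crossFam_of_ne cross4 c cross4_injective i hjk
  · rw [Finset.disjoint_left]
    intro ω hω hω'
    obtain ⟨-, e1, -⟩ := (mem_crossFam cross4 c).1 hω'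
    rcases Finset.mem_union.1 hω with h | h
    · obtain ⟨-, e2, -⟩ := (mem_crossFam cross4 c).1 h
      exact hik (cross4_injective (e2.symm.trans e1))
    · obtain ⟨-, e2, -⟩ := (mem_crossFam cross4 c).1 h
      exact hik (cross4_injective (e2.symm.trans e1))

/-- **The overlap bound with the split bonus (T′⁺)**: when all three types occur (the four
classes `crossFam i j`, `crossFam k j`, `crossFam i k`, `crossFam j k` are nonempty),
`crossCount + p_jk + 2 ≤ topBotCount + |D(famA) ∩ D(famB)|`. -/
theorem crossCount_add_add_two_le_topBotCount_add_inter (c : Config S → Setoid (Fin 4))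
    (hc : Monotone c) {i j k : Fin 3} (hij : i ≠ j) (hik : i ≠ k) (hjk : j ≠ k)
    (h1 : (crossFam cross4 c i j).Nonempty) (h2 : (crossFam cross4 c k j).Nonempty)
    (h3 : (crossFam cross4 c i k).Nonempty) (h4 : (crossFam cross4 c j k).Nonempty) :
    crossCount cross4 c + (crossFam cross4 c j k).card + 2 ≤ topBotCount c +
      ((famA c i j k \\ famA c i j k) ∩ (famB c i j k \\ famB c i j k)).card := by
  have hA := card_famA_add_one_le hc hik h1 h2
  have hB := card_famB_add_one_le hc hij h3 h4
  have hU : ((famA c i j k \\ famA c i j k) ∪ (famB c i j k \\ famB c i j k)).card ≤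
      topBotCount c := by
    rw [← card_botSet]
    exact Finset.card_le_card (Finset.union_subset (diffs_famA_subset hc hij hjk)
      (diffs_famB_subset hc hik hjk))
  have hUI := Finset.card_union_add_card_inter (famA c i j k \\ famA c i j k)
    (famB c i j k \\ famB c i j k)
  have hcross := crossCount_eq_transversal_three c hij hik hjk
  rw [card_famA c hik] at hA
  rw [card_famB c hij] at hB
  omega

/-- **Lemma B whenever the two difference families overlap in at most `p_jk + 2` sets** (for some
labelling with all three types present). -/
theorem crossCount_le_topBotCount_of_inter_le_add_two (c : Config S → Setoid (Fin 4))
    (hc : Monotone c) {i j k : Fin 3} (hij : i ≠ j) (hik : i ≠ k) (hjk : j ≠ k)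
    (h1 : (crossFam cross4 c i j).Nonempty) (h2 : (crossFam cross4 c k j).Nonempty)
    (h3 : (crossFam cross4 c i k).Nonempty) (h4 : (crossFam cross4 c j k).Nonempty)
    (h : ((famA c i j k \\ famA c i j k) ∩ (famB c i j k \\ famB c i j k)).card ≤
      (crossFam cross4 c j k).card + 2) : crossCount cross4 c ≤ topBotCount c := by
  have := crossCount_add_add_two_le_topBotCount_add_inter c hc hij hik hjk h1 h2 h3 h4
  omega

/-- With all three types present every crossing class is nonempty. -/
theorem crossFam_nonempty_of_threeTypes {c : Config S → Setoid (Fin 4)} (h : ThreeTypes c)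
    {i j : Fin 3} (hij : i ≠ j) : (crossFam cross4 c i j).Nonempty := by
  obtain ⟨ω, h1, h2⟩ := h i j hij
  exact ⟨ω, (mem_crossFam cross4 c).2 ⟨hij, h1, h2⟩⟩

/-- **(T′⁺) under `ThreeTypes`**. -/
theorem crossCount_add_add_two_le_topBotCount_add_inter_of_threeTypes
    (c : Config S → Setoid (Fin 4)) (hc : Monotone c) (h3 : ThreeTypes c) {i j k : Fin 3}
    (hij : i ≠ j) (hik : i ≠ k) (hjk : j ≠ k) :
    crossCount cross4 c + (crossFam cross4 c j k).card + 2 ≤ topBotCount c +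
      ((famA c i j k \\ famA c i j k) ∩ (famB c i j k \\ famB c i j k)).card :=
  crossCount_add_add_two_le_topBotCount_add_inter c hc hij hik hjk
    (crossFam_nonempty_of_threeTypes h3 hij) (crossFam_nonempty_of_threeTypes h3 (Ne.symm hjk))
    (crossFam_nonempty_of_threeTypes h3 hik) (crossFam_nonempty_of_threeTypes h3 hjk)

/-- **Lemma B whenever the overlap is at most `p_jk + 2`**, with all three types present; when a
type is absent Lemma B is the column theorem (`crossCount_le_topBotCount_of_column`), so
the hypothesis `ThreeTypes` is the only case left open by the landed regime theorems. -/
theorem crossCount_le_topBotCount_of_inter_le_add_two_of_threeTypes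
    (c : Config S → Setoid (Fin 4)) (hc : Monotone c) (h3 : ThreeTypes c) {i j k : Fin 3}
    (hij : i ≠ j) (hik : i ≠ k) (hjk : j ≠ k)
    (h : ((famA c i j k \\ famA c i j k) ∩ (famB c i j k \\ famB c i j k)).card ≤
      (crossFam cross4 c j k).card + 2) : crossCount cross4 c ≤ topBotCount c := by
  have := crossCount_add_add_two_le_topBotCount_add_inter_of_threeTypes c hc h3 hij hik hjk
  omega

end TransversalSplit

end PercRepro
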